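import Mathlib
import Summits.ResolutionOfSingularities.ResolutionOfSingularities.Theorems.RadicialJungCleanModelsCleanLU3ArcTools
import Summits.ResolutionOfSingularities.ResolutionOfSingularities.Theorems.RadicialJungCleanModelsCleanLU3ArcPrelims
import Literature.AlgebraicGeometry.Resolution.LocalBlowup
import HarnessLib

/-!
# Census (res-B-lens-5 g7, lens 5): PROVED bricks (P0), (P1), (P2) of THEOREM P and the typed core statement
# `ArcPotentialCoreAt` in the currency of ✓ `arc_core`

Companion of `Census_lens5_arcPotential.lean` (commit 46f6cec37822) and of the hand proof
`CLASSA-allfields-potential-lens5.md` (commit e709ae1b8c5f), both in this directory.  Crux of record stmt-ResolutionOfSingularities-0549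
(FIXED, not restated); 15917-side bookkeeping for the lead `res-B-lead-1` (skeleton `Cruxes/CleanModels/Lines/Sketch.lean` rev 20).
bears_on: LADDER-RESOLUTION:B · [OURS · CANDIDATE] counted 0; nothing here proves resolution in characteristic `p`; no `sorry`.

Bricks (all elementary, any dimension, any residue field):
* `exists_derivation_pow_mul`, `jacobian_bound`, `jacobian_bound_of_isUnit` — (P1): if a derivation `D` of `K` preserves `R ∋ π`,
  `D π ∈ π R`, and `D (π^a F) = π^e u` with `u ∉ π R` (e.g. `u` a unit of the local `R`, `π ∈ 𝔪_R`), then `a ≤ e`.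
* `valuation_le_sq_of_mem_sq`, `sub_mul_not_mem_sq`, `indep_of_valuation` — (P2): in a local `R ⊆ K` dominated by `O` with value
  generator `π`, an `F ∈ 𝔪_R ∖ 𝔪_R²` with `v(F) ≤ v(π)²` is linearly independent from `π` modulo `𝔪_R²`.
* `ArcPotentialCoreAt p` — THEOREM P's core in the currency of ✓ `arc_core` (sequence `R : ℕ → Subring K` of quadratic transforms along
  `O`, value generator `π ∈ R 0`, derivation preserving `R 0` moving `h`): typed statement only.
-/

noncomputable section

set_option linter.dupNamespace false

open IsLocalRing
open Literature.AlgebraicGeometry.Resolution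

namespace Summit.ResolutionOfSingularities.ResolutionOfSingularities.Cruxes.DescentPerfectToAll.CpSibling.ArcPotentialCore

variable {K : Type} [Field K]

/-! ## (P1) The Jacobian bound -/

/-- Leibniz bookkeeping: if `D` preserves `R`, `D π = π ε` with `ε ∈ R` and `F ∈ R`, then `D (π^a F) = π^a Φ` with `Φ ∈ R`
(`Φ = D F + a ε F`). [folklore] -/
theorem exists_derivation_pow_mul (D : Derivation ℤ K K) {R : Subring K} (hD : ∀ y ∈ R, D y ∈ R)
    {π : K} (hDπ : ∃ ε ∈ R, D π = π * ε) {F : K} (hF : F ∈ R) (a : ℕ) :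
    ∃ Φ ∈ R, D (π ^ a * F) = π ^ a * Φ := by
  obtain ⟨ε, hε, hDπ⟩ := hDπ
  induction a with
  | zero => exact ⟨D F, hD F hF, by simp⟩
  | succ n ih =>
    obtain ⟨Φ, hΦ, hn⟩ := ih
    refine ⟨Φ + F * ε, R.add_mem hΦ (R.mul_mem hF hε), ?_⟩
    have h1 : π ^ (n + 1) * F = π * (π ^ n * F) := by ring
    rw [h1, Derivation.leibniz, smul_eq_mul, smul_eq_mul, hn, hDπ]
    ring

/-- **(P1) Jacobian bound.**  If `D` preserves `R`, `D π ∈ π R`, `F ∈ R`, `u ∉ π R`, and `D (π^a F) = π^e u`, then `a ≤ e`.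
(In THEOREM P: `D = E_N = π^{N−N₀} E`, `E_N (h − c^p) = E_N h = π^{e_N}·u₀` with `u₀` a unit, and `h − c^p = π^a F`; so
`ord_π(h − c^p) ≤ e_N` for every `c ∈ R N`.) [folklore] -/
theorem jacobian_bound (D : Derivation ℤ K K) {R : Subring K} (hD : ∀ y ∈ R, D y ∈ R)
    {π : K} (hπR : π ∈ R) (hπ0 : π ≠ 0) (hDπ : ∃ ε ∈ R, D π = π * ε)
    {F u : K} (hF : F ∈ R) (hu : ∀ G ∈ R, u ≠ π * G) {a e : ℕ}
    (h : D (π ^ a * F) = π ^ e * u) : a ≤ e := by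
  by_contra hle
  have hlt : e < a := not_le.mp hle
  obtain ⟨Φ, hΦ, hΦeq⟩ := exists_derivation_pow_mul D hD hDπ hF a
  obtain ⟨d, hd⟩ := Nat.exists_eq_add_of_lt hlt
  apply hu (π ^ d * Φ) (R.mul_mem (R.pow_mem hπR d) hΦ)
  have h1 : π ^ e * u = π ^ e * (π * (π ^ d * Φ)) := by
    rw [← h, hΦeq, hd]; ring
  exact mul_left_cancel₀ (pow_ne_zero e hπ0) h1

/-- (P1) for a unit `u` of a local `R` with `π ∈ 𝔪_R`, `π ≠ 0`. [folklore] -/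
theorem jacobian_bound_of_isUnit (D : Derivation ℤ K K) {R : Subring K} [IsLocalRing R] (hD : ∀ y ∈ R, D y ∈ R)
    {π : K} (hπR : π ∈ R) (hπ0 : π ≠ 0) (hπm : (⟨π, hπR⟩ : R) ∈ maximalIdeal R) (hDπ : ∃ ε ∈ R, D π = π * ε)
    {F u : K} (hF : F ∈ R) (huR : u ∈ R) (hunit : IsUnit (⟨u, huR⟩ : R)) {a e : ℕ}
    (h : D (π ^ a * F) = π ^ e * u) : a ≤ e := by
  refine jacobian_bound D hD hπR hπ0 hDπ hF (fun G hG hG' => ?_) h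
  have hmem : (⟨u, huR⟩ : R) ∈ maximalIdeal R := by
    have h1 : (⟨u, huR⟩ : R) = ⟨G, hG⟩ * ⟨π, hπR⟩ :=
      Subtype.ext (by change u = G * π; rw [hG', mul_comm])
    rw [h1]
    exact (maximalIdeal R).mul_mem_left _ hπm
  exact (IsLocalRing.mem_maximalIdeal _).mp hmem hunit

/-! ## (P2) The valuative detector: independence of `π` and `F` modulo `𝔪²` -/

variable {O : ValuationSubring K}

/-- Elements of `𝔪_R²` have value `≤ v(π)²` when `R` is dominated by `O` and `v(π)` bounds every value `< 1`. [folklore] -/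
theorem valuation_le_sq_of_mem_sq {R : Subring K} [IsLocalRing R] (hdom : SubringDominates R O.toSubring)
    {π : K} (hπ : ∀ x : K, O.valuation x < 1 → O.valuation x ≤ O.valuation π)
    (y : R) (hy : y ∈ maximalIdeal R ^ 2) : O.valuation (y : K) ≤ O.valuation π ^ 2 := by
  have hmem : ∀ a : R, a ∈ maximalIdeal R ↔ O.valuation (a : K) < 1 :=
    (subringDominates_valuationSubring_iff hdom.1).mp hdom
  rw [pow_two] at hy
  refine Submodule.mul_induction_on hy (fun a ha b hb => ?_) (fun a b ha hb => ?_)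
  · rw [Subring.coe_mul, map_mul, pow_two]
    exact mul_le_mul' (hπ _ ((hmem a).mp ha)) (hπ _ ((hmem b).mp hb))
  · rw [Subring.coe_add]
    exact Valuation.map_add_le _ ha hb

/-- If `v(x·π) ≤ v(π)²` with `0 < v(π) < 1` then `v(x) < 1`. [folklore] -/
theorem valuation_lt_one_of_mul_le_sq {π x : K} (hπ0 : π ≠ 0) (hvπ1 : O.valuation π < 1)
    (hx : O.valuation (x * π) ≤ O.valuation π ^ 2) : O.valuation x < 1 := by
  have hvπ0 : 0 < O.valuation π := zero_lt_iff.mpr ((Valuation.ne_zero_iff _).mpr hπ0)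
  rw [map_mul, pow_two, mul_comm] at hx
  exact lt_of_le_of_lt (le_of_mul_le_mul_left hx hvπ0) hvπ1

/-- **(P2), first form.**  `F ∉ 𝔪²` with `v(F) ≤ v(π)²` cannot differ from a multiple of `π` by an element of `𝔪²`. [folklore] -/
theorem sub_mul_not_mem_sq {R : Subring K} [IsLocalRing R] (hdom : SubringDominates R O.toSubring)
    {π : K} (hπR : π ∈ R) (hπ0 : π ≠ 0) (hπm : (⟨π, hπR⟩ : R) ∈ maximalIdeal R)
    (hπ : ∀ x : K, O.valuation x < 1 → O.valuation x ≤ O.valuation π)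
    (F : R) (hF2 : F ∉ maximalIdeal R ^ 2) (hvF : O.valuation (F : K) ≤ O.valuation π ^ 2) (l : R) :
    F - l * ⟨π, hπR⟩ ∉ maximalIdeal R ^ 2 := by
  have hmem : ∀ a : R, a ∈ maximalIdeal R ↔ O.valuation (a : K) < 1 :=
    (subringDominates_valuationSubring_iff hdom.1).mp hdom
  intro hq
  have hvq := valuation_le_sq_of_mem_sq hdom hπ _ hq
  have hvlπ : O.valuation ((l : K) * π) ≤ O.valuation π ^ 2 := by
    have h1 : (l : K) * π = (F : K) - ((F - l * ⟨π, hπR⟩ : R) : K) := by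
      push_cast
      ring
    rw [h1]
    exact Valuation.map_sub_le _ hvF hvq
  have hvπ1 : O.valuation π < 1 := (hmem ⟨π, hπR⟩).mp hπm
  have hlm : l ∈ maximalIdeal R := (hmem l).mpr (valuation_lt_one_of_mul_le_sq hπ0 hvπ1 hvlπ)
  apply hF2
  have h2 : F = (F - l * ⟨π, hπR⟩) + l * ⟨π, hπR⟩ := by ring
  rw [h2]
  exact (maximalIdeal R ^ 2).add_mem hq (by rw [pow_two]; exact Ideal.mul_mem_mul hlm hπm)

/-- **(P2), independence form.**  With `F ∈ 𝔪 ∖ 𝔪²` and `v(F) ≤ v(π)²`: if `a π + b F ∈ 𝔪²` then `a, b ∈ 𝔪` — the images of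
`π` and `F` in `𝔪/𝔪²` are linearly independent, so in a regular local ring they extend to a regular system of parameters (and THEOREM P
reads off loose clean form (1) or (3) for `π^a F`). [folklore] -/
theorem indep_of_valuation {R : Subring K} [IsLocalRing R] (hdom : SubringDominates R O.toSubring)
    {π : K} (hπR : π ∈ R) (hπ0 : π ≠ 0) (hπm : (⟨π, hπR⟩ : R) ∈ maximalIdeal R)
    (hπ : ∀ x : K, O.valuation x < 1 → O.valuation x ≤ O.valuation π)
    (F : R) (hFm : F ∈ maximalIdeal R) (hF2 : F ∉ maximalIdeal R ^ 2) (hvF : O.valuation (F : K) ≤ O.valuation π ^ 2)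
    (a b : R) (hab : a * ⟨π, hπR⟩ + b * F ∈ maximalIdeal R ^ 2) : a ∈ maximalIdeal R ∧ b ∈ maximalIdeal R := by
  have hmem : ∀ a : R, a ∈ maximalIdeal R ↔ O.valuation (a : K) < 1 :=
    (subringDominates_valuationSubring_iff hdom.1).mp hdom
  -- `b ∈ 𝔪`: otherwise `b` is a unit and `F + b⁻¹ a π ∈ 𝔪²`
  have hb : b ∈ maximalIdeal R := by
    by_contra hbu
    have hbunit : IsUnit b := by
      rwa [IsLocalRing.mem_maximalIdeal, mem_nonunits_iff, not_not] at hbu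
    obtain ⟨w, hw⟩ := hbunit.exists_left_inv
    have h1 : F - (-(w * a)) * ⟨π, hπR⟩ ∈ maximalIdeal R ^ 2 := by
      have h2 : F - (-(w * a)) * ⟨π, hπR⟩ = w * (a * ⟨π, hπR⟩ + b * F) := by
        have h3 : w * (a * ⟨π, hπR⟩ + b * F) = w * a * ⟨π, hπR⟩ + (w * b) * F := by ring
        rw [h3, hw]; ring
      rw [h2]
      exact (maximalIdeal R ^ 2).mul_mem_left _ hab
    exact sub_mul_not_mem_sq hdom hπR hπ0 hπm hπ F hF2 hvF _ h1
  refine ⟨?_, hb⟩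
  -- `a π = (a π + b F) - b F ∈ 𝔪²`, so `v(a π) ≤ v(π)²`, so `v(a) < 1`
  have haπ : a * ⟨π, hπR⟩ ∈ maximalIdeal R ^ 2 := by
    have h1 : a * ⟨π, hπR⟩ = (a * ⟨π, hπR⟩ + b * F) - b * F := by ring
    rw [h1]
    exact (maximalIdeal R ^ 2).sub_mem hab (by rw [pow_two]; exact Ideal.mul_mem_mul hb hFm)
  have hv := valuation_le_sq_of_mem_sq hdom hπ _ haπ
  rw [Subring.coe_mul] at hv
  have hvπ1 : O.valuation π < 1 := (hmem ⟨π, hπR⟩).mp hπm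
  exact (hmem a).mpr (valuation_lt_one_of_mul_le_sq hπ0 hvπ1 hv)

/-! ## (P0) Values of `h − c^p` are `p`-divisible powers of `v(π)` (best-approximation argument, no completion) -/

/-- **(P0).**  For a discrete rank-one `O` (value generator `π`, `0 < v π < 1`), in characteristic `p`: if `h ∈ O` is not a `p`-th power
and has NO best `p`-th-power approximation, then for every `c ∈ O` the value `v(h − c^p)` is `v(π)^{p j}` for some `j` — otherwise,
since `v(c^p − c'^p) = v(c − c')^p` is always a `p`-divisible power, `c` would be a best approximation. [folklore] -/
theorem valuation_sub_pow_eq_pow_mul {p : ℕ} [Fact p.Prime] [CharP K p] (O : ValuationSubring K) (π : K) (hπ0 : π ≠ 0)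
    (hvπ1 : O.valuation π < 1)
    (hπ : ∀ x : K, O.valuation x < 1 → O.valuation x ≤ O.valuation π)
    (harch : ∀ x : K, x ≠ 0 → ∃ n : ℕ, O.valuation π ^ n ≤ O.valuation x)
    (h : K) (hh : h ∈ O) (hnp : ∀ c : K, c ^ p ≠ h)
    (hdefect : ∀ c : K, ∃ c' : K, O.valuation (h - c' ^ p) < O.valuation (h - c ^ p))
    (c : K) (hc : c ∈ O) : ∃ j : ℕ, O.valuation (h - c ^ p) = O.valuation π ^ (p * j) := by
  have hvπ0 : 0 < O.valuation π := zero_lt_iff.mpr ((Valuation.ne_zero_iff _).mpr hπ0)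
  have hinj : Function.Injective (fun n : ℕ => O.valuation π ^ n) := (pow_right_strictAnti₀ hvπ0 hvπ1).injective
  have hf0 : h - c ^ p ≠ 0 := sub_ne_zero.mpr (Ne.symm (hnp c))
  have hfO : h - c ^ p ∈ O := O.sub_mem hh (O.pow_mem hc p)
  obtain ⟨n, hn⟩ :=
    Summit.ResolutionOfSingularities.ResolutionOfSingularities.Theorems.RadicialJung.CleanModels.exists_valuation_eq_pow_of_discrete
      O π hπ harch (h - c ^ p) hf0 hfO
  by_cases hpn : p ∣ n
  · obtain ⟨j, rfl⟩ := hpn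
    exact ⟨j, hn⟩
  exfalso
  obtain ⟨c', hc'⟩ := hdefect c
  -- `c' ∈ O`: otherwise `v(h − c'^p) = v(c'^p) > 1 ≥ v(h − c^p)`
  have hle1 : O.valuation (h - c ^ p) ≤ 1 := (O.valuation_le_one_iff _).mpr hfO
  have hc'O : c' ∈ O := by
    by_contra hc'O
    have hvc' : 1 < O.valuation c' := by
      rw [← not_le, O.valuation_le_one_iff]; exact hc'O
    have hvc'p : 1 < O.valuation (c' ^ p) := by
      rw [map_pow]; exact one_lt_pow₀ hvc' (Fact.out : p.Prime).ne_zero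
    have hvh : O.valuation h < O.valuation (c' ^ p) := lt_of_le_of_lt ((O.valuation_le_one_iff _).mpr hh) hvc'p
    have heq : O.valuation (h - c' ^ p) = O.valuation (c' ^ p) := Valuation.map_sub_eq_of_lt_right _ hvh
    have : O.valuation (h - c' ^ p) ≤ 1 := (hc'.le.trans hle1)
    rw [heq] at this
    exact absurd hvc'p (not_lt.mpr this)
  -- `d := c^p − c'^p = (h − c'^p) − (h − c^p)` has value `v(h − c^p) = v(π)^n`
  have hd : O.valuation (c ^ p - c' ^ p) = O.valuation π ^ n := by
    have h1 : c ^ p - c' ^ p = (h - c' ^ p) - (h - c ^ p) := by ring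
    rw [h1, Valuation.map_sub_eq_of_lt_right _ hc', hn]
  -- and is `(c − c')^p`
  have hd' : c ^ p - c' ^ p = (c - c') ^ p := (sub_pow_char c c').symm
  have hcc0 : c - c' ≠ 0 := by
    intro h0
    have : O.valuation (c ^ p - c' ^ p) = 0 := by rw [hd', h0, zero_pow (Fact.out : p.Prime).ne_zero, map_zero]
    rw [hd] at this
    exact (pow_ne_zero n hvπ0.ne') this
  obtain ⟨j, hj⟩ :=
    Summit.ResolutionOfSingularities.ResolutionOfSingularities.Theorems.RadicialJung.CleanModels.exists_valuation_eq_pow_of_discrete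
      O π hπ harch (c - c') hcc0 (O.sub_mem hc hc'O)
  have hpow : O.valuation π ^ n = O.valuation π ^ (p * j) := by
    rw [← hd, hd', map_pow, hj, ← pow_mul, mul_comm]
  exact hpn ⟨j, hinj hpow⟩

/-! ## The core statement of THEOREM P in the currency of ✓ `arc_core` (typed only) -/

/-- TARGET «THEOREM P, core form» (compare ✓ `arc_core`, p681465): along a sequence of quadratic transforms of 3-dimensional regular
local rings of `K` following `O`, with a value generator `π ∈ R 0` of the discrete rank-one `O` and a derivation `E` of `K` preserving
`R 0` and moving `h ∈ R 0`, where `h` is not a `p`-th power and has no best `p`-th-power approximation: at some stage `R n` some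
representative `(h − c^p)/π^{p m'}` (`c ∈ R n`) is `π^r · t₁` over an r.s.p. `(π, t₁, t₂)` with `0 < r < p` (loose form (1)), or a unit
whose residue is not a `p`-th power (loose form (2)), or a regular parameter (loose form (3)).  NO hypothesis on residue fields; `arc_core`'s
depth-`M` arc coordinates `(u, w)` and accuracy `hprec` are gone.  Proof on paper: memo §2 (P0)–(P5); bricks (P1), (P2) above.
[folklore] -/
def ArcPotentialCoreAt (p : ℕ) : Prop :=
  ∀ (K : Type) [Field K] [CharP K p] (O : ValuationSubring K) (R : ℕ → Subring K) [∀ i, IsLocalRing (R i)],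
    (∀ i, IsRegularLocalRing (R i)) → (∀ i, ringKrullDim (R i) = 3) →
    SubringDominates (R 0) O.toSubring → (∀ i, IsQuadraticTransformAlong O (R i) (R (i + 1))) →
    ∀ (π : K), π ∈ R 0 → π ≠ 0 → (∀ x : K, O.valuation x < 1 → O.valuation x ≤ O.valuation π) →
    (∀ x : K, x ≠ 0 → ∃ n : ℕ, O.valuation π ^ n ≤ O.valuation x) →
    ∀ (E : Derivation ℤ K K), (∀ y ∈ R 0, E y ∈ R 0) →
    ∀ (h : K), h ∈ R 0 → E h ≠ 0 → (∀ c : K, c ^ p ≠ h) →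
    (∀ c : K, ∃ c' : K, O.valuation (h - c' ^ p) < O.valuation (h - c ^ p)) →
    ∃ (n m' : ℕ) (c : K), c ∈ R n ∧
      ((∃ (t : Fin 3 → R n) (r : ℕ), Ideal.span (Set.range t) = maximalIdeal (R n) ∧ ((t 0 : R n) : K) = π ∧ 0 < r ∧ r < p ∧
          (h - c ^ p) / π ^ (p * m') = ((t 0 : R n) : K) ^ r * ((t 1 : R n) : K)) ∨
       (∃ G : R n, IsUnit G ∧ (∀ c' : R n, G - c' ^ p ∉ maximalIdeal (R n)) ∧ (G : K) = (h - c ^ p) / π ^ (p * m')) ∨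
       (∃ G : R n, G ∈ maximalIdeal (R n) ∧ G ∉ maximalIdeal (R n) ^ 2 ∧ (G : K) = (h - c ^ p) / π ^ (p * m')))

end Summit.ResolutionOfSingularities.ResolutionOfSingularities.Cruxes.DescentPerfectToAll.CpSibling.ArcPotentialCore
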